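import Summits.NavierStokesRegularity.NavierStokesRegularity.Theorems.PoloidalWindowDoorPoloidalWindowRigidityZShockPeriodicVirial
import HarnessLib

/-!
# Crux K2 `PoloidalWindowRigidity` (stmt-NavierStokesRegularity-19708), line `z_shock` — the BREATHER BOUND: on a hyperbolic column the
# height-periodic energy of `w − w⋆` inside a ball is paid by the energy in the unit shell around it, times the radius

`--supports stmt-NavierStokesRegularity-19708 --as helper` (leafhand-ns-poloidalwindowdoor-3 g11, cell decomp-ns, 2026-08-31).  Def-free; tree files
`…ZShockVirialLaw`, `…ZShockPeriodicVirial` (this seat) and the cutoff tools of `…ZShockLocalEnergyCutoff`.  **No stub and no summit is closed by this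
file; Navier–Stokes regularity is NOT proved here (rung 0).**

* ★ `periodic_virial_le` — jointly smooth `(u, w)` obeying the autonomous height-evolution (`∂ₛuᵢ = G(w)∂ᵢw`, `∂ₛw = −div u`, `∂₁u₀ = ∂₀u₁`),
  `P`-periodic in the height (`P ≥ 0`), on a UNIFORMLY HYPERBOLIC column `−γhi ≤ G ≤ −γlo`, `γlo ≥ 0`, with the centred virial potential
  `Θ(w⋆) = 0`, `Θ' (r) = (r − w⋆)G(r)`; then for every cutoff radius `a`

    `∫₀ᴾ ∫ χ_a(y)·γlo (w − w⋆)² dy ds ≤ ∫₀ᴾ ∫ |χ_a'(⟨y⟩)|·⟨y⟩·(³⁄₂|u|² + (γhi/2)(w − w⋆)²) dy ds`,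

  `χ_a(y) = smoothTransition(a + 1 − ⟨y⟩)` (`= 1` on `⟨y⟩ ≤ a`, `= 0` on `⟨y⟩ ≥ a + 1`), `⟨y⟩ = √(1 + |y|²)`.  The right-hand side lives in the shell
  `a ≤ ⟨y⟩ ≤ a + 1` and carries ONE factor `⟨y⟩ ≤ a + 1`.

CONSEQUENCE (the limiting step, recorded for the census and not formalised here): if the horizontal energy is finite uniformly over a period,
`sup_s ∫ (|u|² + (w − w⋆)²) dy < ∞`, the shell energies are summable in `a`, so `(a+1)·(shell energy) → 0` along a subsequence, the left side
tends to `γlo ∫₀ᴾ∫(w − w⋆)²`, and `w ≡ w⋆`: an autonomous hyperbolic height-evolution carries NO horizontally localised height-periodic pattern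
(breather) other than the frozen ones (`w` constant, `u` height-independent and harmonic) — thick or thin alike.

Honest scope: M-sized; kinematic; no genuine nonlinearity used (so it does not separate the THICK column from (TH)); it removes one inhabitant family of
the R3 falsifier row (card `Lines/z_shock.md` §Instrument row) up to the stated limiting step. presearch: see `…ZShockVirialLaw` (Vuillermot/Coron,
semilinear breathers). [folklore]
-/

noncomputable section

namespace Summit.NavierStokesRegularity.NavierStokesRegularity.Theorems.PoloidalWindowDoorPoloidalWindowRigidityZShockBreatherBound

-- the summit and its single sub-problem share the name (CONVENTIONS §1)
set_option linter.dupNamespace false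

open Set Filter Topology Function MeasureTheory Metric
open scoped ContDiff
open Literature.Analysis.FluidPDE (continuousOn_integral_of_support_subset)
open Summit.NavierStokesRegularity.NavierStokesRegularity.Theorems.PoloidalWindowDoorPoloidalWindowRigidityZShockVirialLaw
open Summit.NavierStokesRegularity.NavierStokesRegularity.Theorems.PoloidalWindowDoorPoloidalWindowRigidityZShockLocalEnergyCutoff
open Summit.NavierStokesRegularity.NavierStokesRegularity.Theorems.PoloidalWindowDoorPoloidalWindowRigidityZShockLocalEnergy
open Summit.NavierStokesRegularity.NavierStokesRegularity.Theorems.PoloidalWindowDoorPoloidalWindowRigidityZShockPeriodicVirial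

variable {u : Fin 2 → ℝ → EuclideanSpace ℝ (Fin 2) → ℝ} {w : ℝ → EuclideanSpace ℝ (Fin 2) → ℝ} {G Θ : ℝ → ℝ} {wstar P γlo γhi : ℝ}

/-- **Pointwise bound of the shell integrand**: with `Θ(w⋆) = 0`, `Θ' = (· − w⋆)G`, `−γhi ≤ G ≤ 0`,
`|χ'/⟨y⟩ · (0·⟨y⟩·e + Σᵢ yᵢfᵢ)| ≤ |χ'|·⟨y⟩·(³⁄₂|u|² + (γhi/2)(w − w⋆)²)`. [folklore] -/
theorem abs_shell_integrand_le (hΘ : ∀ r, HasDerivAt Θ ((r - wstar) * G r) r) (hΘ0 : Θ wstar = 0)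
    (hG0 : ∀ r, G r ≤ 0) (hGhi : ∀ r, -γhi ≤ G r) (D E : ℝ) (s : ℝ) (y : EuclideanSpace ℝ (Fin 2)) :
    |D / √(1 + ‖y‖ ^ 2) * (0 * √(1 + ‖y‖ ^ 2) * E +
        ∑ i : Fin 2, y i * ((y 0 * u 0 s y + y 1 * u 1 s y) * u i s y
          - (1 / 2) * (u 0 s y ^ 2 + u 1 s y ^ 2) * y i - Θ (w s y) * y i))| ≤
      |D| * (√(1 + ‖y‖ ^ 2) * ((3 / 2) * (u 0 s y ^ 2 + u 1 s y ^ 2) + (γhi / 2) * (w s y - wstar) ^ 2)) := by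
  have hb := bracket_pos y
  have hT0 : Θ (w s y) ≤ 0 := theta_nonpos hΘ hΘ0 hG0 _
  have hT : -(γhi / 2) * (w s y - wstar) ^ 2 ≤ Θ (w s y) := theta_ge_neg_sq hΘ hΘ0 hGhi _
  have hfm := abs_fluxMoment_le (y 0) (y 1) (u 0 s y) (u 1 s y) (Θ (w s y)) (w s y - wstar) γhi hT0 hT
  rw [Fin.sum_univ_two, zero_mul, zero_mul, zero_add, abs_mul, abs_div, abs_of_pos hb]
  have hK : 0 ≤ (3 / 2) * (u 0 s y ^ 2 + u 1 s y ^ 2) + (γhi / 2) * (w s y - wstar) ^ 2 := by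
    have : 0 ≤ (γhi / 2) * (w s y - wstar) ^ 2 := by nlinarith [hT0, hT]
    positivity
  have hn : ‖y‖ ^ 2 = y 0 ^ 2 + y 1 ^ 2 := by
    rw [EuclideanSpace.norm_sq_eq, Fin.sum_univ_two]
    simp [sq_abs]
  have hy2 : y 0 ^ 2 + y 1 ^ 2 ≤ √(1 + ‖y‖ ^ 2) ^ 2 := by
    rw [Real.sq_sqrt (by positivity), ← hn]; linarith
  calc |D| / √(1 + ‖y‖ ^ 2) *
        |y 0 * ((y 0 * u 0 s y + y 1 * u 1 s y) * u 0 s y - 1 / 2 * (u 0 s y ^ 2 + u 1 s y ^ 2) * y 0 - Θ (w s y) * y 0) +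
          y 1 * ((y 0 * u 0 s y + y 1 * u 1 s y) * u 1 s y - 1 / 2 * (u 0 s y ^ 2 + u 1 s y ^ 2) * y 1 - Θ (w s y) * y 1)|
      ≤ |D| / √(1 + ‖y‖ ^ 2) *
          ((y 0 ^ 2 + y 1 ^ 2) * ((3 / 2) * (u 0 s y ^ 2 + u 1 s y ^ 2) + (γhi / 2) * (w s y - wstar) ^ 2)) :=
        mul_le_mul_of_nonneg_left hfm (by positivity)
    _ ≤ |D| / √(1 + ‖y‖ ^ 2) *
          (√(1 + ‖y‖ ^ 2) ^ 2 * ((3 / 2) * (u 0 s y ^ 2 + u 1 s y ^ 2) + (γhi / 2) * (w s y - wstar) ^ 2)) :=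
        mul_le_mul_of_nonneg_left (mul_le_mul_of_nonneg_right hy2 hK) (by positivity)
    _ = |D| * (√(1 + ‖y‖ ^ 2) * ((3 / 2) * (u 0 s y ^ 2 + u 1 s y ^ 2) + (γhi / 2) * (w s y - wstar) ^ 2)) := by
        field_simp

/-- ★ **The breather bound** (hypotheses in the module docstring). [folklore] -/
theorem periodic_virial_le (hu : ∀ i, ContDiff ℝ ∞ (uncurry (u i))) (hw : ContDiff ℝ ∞ (uncurry w))
    (hΘs : ContDiff ℝ ∞ Θ) (hΘ : ∀ r, HasDerivAt Θ ((r - wstar) * G r) r) (hΘ0 : Θ wstar = 0)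
    (hγlo : 0 ≤ γlo) (hGlo : ∀ r, G r ≤ -γlo) (hGhi : ∀ r, -γhi ≤ G r)
    (hus : ∀ i s y, HasDerivAt (fun s' => u i s' y) (G (w s y) * fderiv ℝ (w s) y (EuclideanSpace.single i 1)) s)
    (hws : ∀ s y, HasDerivAt (fun s' => w s' y)
      (-(fderiv ℝ (u 0 s) y (EuclideanSpace.single 0 1) + fderiv ℝ (u 1 s) y (EuclideanSpace.single 1 1))) s)
    (hpol : ∀ s y, fderiv ℝ (u 0 s) y (EuclideanSpace.single 1 1) = fderiv ℝ (u 1 s) y (EuclideanSpace.single 0 1))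
    (hP : 0 ≤ P) (hPu : ∀ i s y, u i (s + P) y = u i s y) (hPw : ∀ s y, w (s + P) y = w s y) (a : ℝ) :
    ∫ s in (0 : ℝ)..P, ∫ y : EuclideanSpace ℝ (Fin 2),
        Real.smoothTransition (a + 1 - (√(1 + ‖y‖ ^ 2) + 0 * s)) * (γlo * (w s y - wstar) ^ 2) ≤
      ∫ s in (0 : ℝ)..P, ∫ y : EuclideanSpace ℝ (Fin 2),
        |deriv (fun v : ℝ => Real.smoothTransition (a + 1 - v)) (√(1 + ‖y‖ ^ 2) + 0 * s)| *
          (√(1 + ‖y‖ ^ 2) * ((3 / 2) * (u 0 s y ^ 2 + u 1 s y ^ 2) + (γhi / 2) * (w s y - wstar) ^ 2)) := by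
  have hG0 : ∀ r, G r ≤ 0 := fun r => (hGlo r).trans (by linarith)
  -- the densities (as in `…ZShockPeriodicVirial`)
  set e : ℝ → EuclideanSpace ℝ (Fin 2) → ℝ := fun s y => (y 0 * u 0 s y + y 1 * u 1 s y) * (w s y - wstar) with he_def
  set f : Fin 2 → ℝ → EuclideanSpace ℝ (Fin 2) → ℝ := fun i s y =>
    (y 0 * u 0 s y + y 1 * u 1 s y) * u i s y - (1 / 2) * (u 0 s y ^ 2 + u 1 s y ^ 2) * y i - Θ (w s y) * y i with hf_def
  have he : ContDiff ℝ ∞ (uncurry e) := smooth_moment hu hw wstar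
  have hf : ∀ i, ContDiff ℝ ∞ (uncurry (f i)) := fun i => smooth_flux hu hw hΘs i
  have hΘw : ContDiff ℝ ∞ (uncurry fun s (y : EuclideanSpace ℝ (Fin 2)) => Θ (w s y)) := hΘs.comp hw
  have hd2 : ContDiff ℝ ∞ (uncurry fun s (y : EuclideanSpace ℝ (Fin 2)) => (w s y - wstar) ^ 2) :=
    (hw.sub contDiff_const).pow 2
  have hu2 : ContDiff ℝ ∞ (uncurry fun s (y : EuclideanSpace ℝ (Fin 2)) => u 0 s y ^ 2 + u 1 s y ^ 2) :=
    ((hu 0).pow 2).add ((hu 1).pow 2)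
  -- the four height functions
  set L : ℝ → ℝ := fun s => ∫ y : EuclideanSpace ℝ (Fin 2),
    Real.smoothTransition (a + 1 - (√(1 + ‖y‖ ^ 2) + 0 * s)) * (γlo * (w s y - wstar) ^ 2) with hL_def
  set S : ℝ → ℝ := fun s => ∫ y : EuclideanSpace ℝ (Fin 2),
    Real.smoothTransition (a + 1 - (√(1 + ‖y‖ ^ 2) + 0 * s)) * (-2 * Θ (w s y)) with hS_def
  set T : ℝ → ℝ := fun s => ∫ y : EuclideanSpace ℝ (Fin 2),
    deriv (fun v : ℝ => Real.smoothTransition (a + 1 - v)) (√(1 + ‖y‖ ^ 2) + 0 * s) / √(1 + ‖y‖ ^ 2) *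
      (0 * √(1 + ‖y‖ ^ 2) * e s y + ∑ i, y i * f i s y) with hT_def
  set R : ℝ → ℝ := fun s => ∫ y : EuclideanSpace ℝ (Fin 2),
    |deriv (fun v : ℝ => Real.smoothTransition (a + 1 - v)) (√(1 + ‖y‖ ^ 2) + 0 * s)| *
      (√(1 + ‖y‖ ^ 2) * ((3 / 2) * (u 0 s y ^ 2 + u 1 s y ^ 2) + (γhi / 2) * (w s y - wstar) ^ 2)) with hR_def
  -- the periodic virial identity
  have hid : ∫ s in (0 : ℝ)..P, S s = -∫ s in (0 : ℝ)..P, T s :=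
    periodic_virial_identity hu hw hΘs hΘ hus hws hpol hPu hPw a
  -- compact support of all integrands
  have hK : IsCompact (closedBall (0 : EuclideanSpace ℝ (Fin 2)) (a + 1)) := isCompact_closedBall _ _
  have hout : ∀ s : ℝ, ∀ y ∉ closedBall (0 : EuclideanSpace ℝ (Fin 2)) (a + 1), a + 1 - 0 * s < ‖y‖ := by
    intro s y hy
    rw [mem_closedBall, dist_zero_right, not_le] at hy
    simpa using hy
  have hbr : ContDiff ℝ ∞ fun p : ℝ × EuclideanSpace ℝ (Fin 2) => √(1 + ‖p.2‖ ^ 2) + 0 * p.1 :=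
    (contDiff_bracket.comp contDiff_snd).add (contDiff_const.mul contDiff_fst)
  have hχc : Continuous fun p : ℝ × EuclideanSpace ℝ (Fin 2) => Real.smoothTransition (a + 1 - (√(1 + ‖p.2‖ ^ 2) + 0 * p.1)) :=
    (contDiff_cutoff_uncurry a 0 (n := 2)).continuous
  have hχ'c : Continuous fun p : ℝ × EuclideanSpace ℝ (Fin 2) =>
      deriv (fun v : ℝ => Real.smoothTransition (a + 1 - v)) (√(1 + ‖p.2‖ ^ 2) + 0 * p.1) :=
    ((contDiff_profile (a + 1) (k := ⊤)).continuous_deriv (by simp)).comp hbr.continuous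
  -- continuity in the height of the four functions
  have hLc : Continuous L := by
    have hΦ : Continuous fun p : ℝ × EuclideanSpace ℝ (Fin 2) =>
        Real.smoothTransition (a + 1 - (√(1 + ‖p.2‖ ^ 2) + 0 * p.1)) * (γlo * (w p.1 p.2 - wstar) ^ 2) :=
      hχc.mul (continuous_const.mul hd2.continuous)
    have h := continuousOn_integral_of_support_subset (μ := (volume : Measure (EuclideanSpace ℝ (Fin 2))))
      (S := univ) (Φ := fun s (y : EuclideanSpace ℝ (Fin 2)) =>
        Real.smoothTransition (a + 1 - (√(1 + ‖y‖ ^ 2) + 0 * s)) * (γlo * (w s y - wstar) ^ 2)) hK hΦ.continuousOn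
      (fun s _ y hy => by
        show Real.smoothTransition (a + 1 - (√(1 + ‖y‖ ^ 2) + 0 * s)) * (γlo * (w s y - wstar) ^ 2) = 0
        rw [cutoff_eq_zero (hout s y hy), zero_mul])
    exact continuousOn_univ.1 h
  have hSc : Continuous S := by
    have hΦ : Continuous fun p : ℝ × EuclideanSpace ℝ (Fin 2) =>
        Real.smoothTransition (a + 1 - (√(1 + ‖p.2‖ ^ 2) + 0 * p.1)) * (-2 * Θ (w p.1 p.2)) :=
      hχc.mul (continuous_const.mul hΘw.continuous)
    have h := continuousOn_integral_of_support_subset (μ := (volume : Measure (EuclideanSpace ℝ (Fin 2))))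
      (S := univ) (Φ := fun s (y : EuclideanSpace ℝ (Fin 2)) =>
        Real.smoothTransition (a + 1 - (√(1 + ‖y‖ ^ 2) + 0 * s)) * (-2 * Θ (w s y))) hK hΦ.continuousOn
      (fun s _ y hy => by
        show Real.smoothTransition (a + 1 - (√(1 + ‖y‖ ^ 2) + 0 * s)) * (-2 * Θ (w s y)) = 0
        rw [cutoff_eq_zero (hout s y hy), zero_mul])
    exact continuousOn_univ.1 h
  have hTc : Continuous T := by
    have hΦ : Continuous fun p : ℝ × EuclideanSpace ℝ (Fin 2) =>
        deriv (fun v : ℝ => Real.smoothTransition (a + 1 - v)) (√(1 + ‖p.2‖ ^ 2) + 0 * p.1) / √(1 + ‖p.2‖ ^ 2) *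
          (0 * √(1 + ‖p.2‖ ^ 2) * e p.1 p.2 + ∑ i, p.2 i * f i p.1 p.2) := by
      refine (hχ'c.div (contDiff_bracket.comp contDiff_snd (n := (⊤ : ℕ∞))).continuous fun p => (bracket_pos p.2).ne').mul ?_
      refine ((continuous_const.mul (contDiff_bracket.comp contDiff_snd (n := (⊤ : ℕ∞))).continuous).mul
        he.continuous).add ?_
      exact continuous_finsetSum _ fun i _ => (contDiff_snd_coord i).continuous.mul (hf i).continuous
    have h := continuousOn_integral_of_support_subset (μ := (volume : Measure (EuclideanSpace ℝ (Fin 2))))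
      (S := univ) (Φ := fun s (y : EuclideanSpace ℝ (Fin 2)) =>
        deriv (fun v : ℝ => Real.smoothTransition (a + 1 - v)) (√(1 + ‖y‖ ^ 2) + 0 * s) / √(1 + ‖y‖ ^ 2) *
          (0 * √(1 + ‖y‖ ^ 2) * e s y + ∑ i, y i * f i s y)) hK hΦ.continuousOn (fun s _ y hy => by
        show deriv (fun v : ℝ => Real.smoothTransition (a + 1 - v)) (√(1 + ‖y‖ ^ 2) + 0 * s) / √(1 + ‖y‖ ^ 2) *
          (0 * √(1 + ‖y‖ ^ 2) * e s y + ∑ i, y i * f i s y) = 0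
        rw [deriv_cutoff_eq_zero (hout s y hy)]; simp)
    exact continuousOn_univ.1 h
  have hRc : Continuous R := by
    have hΦ : Continuous fun p : ℝ × EuclideanSpace ℝ (Fin 2) =>
        |deriv (fun v : ℝ => Real.smoothTransition (a + 1 - v)) (√(1 + ‖p.2‖ ^ 2) + 0 * p.1)| *
          (√(1 + ‖p.2‖ ^ 2) * ((3 / 2) * (u 0 p.1 p.2 ^ 2 + u 1 p.1 p.2 ^ 2) + (γhi / 2) * (w p.1 p.2 - wstar) ^ 2)) :=
      hχ'c.abs.mul ((contDiff_bracket.comp contDiff_snd (n := (⊤ : ℕ∞))).continuous.mul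
        ((continuous_const.mul hu2.continuous).add (continuous_const.mul hd2.continuous)))
    have h := continuousOn_integral_of_support_subset (μ := (volume : Measure (EuclideanSpace ℝ (Fin 2))))
      (S := univ) (Φ := fun s (y : EuclideanSpace ℝ (Fin 2)) =>
        |deriv (fun v : ℝ => Real.smoothTransition (a + 1 - v)) (√(1 + ‖y‖ ^ 2) + 0 * s)| *
          (√(1 + ‖y‖ ^ 2) * ((3 / 2) * (u 0 s y ^ 2 + u 1 s y ^ 2) + (γhi / 2) * (w s y - wstar) ^ 2))) hK hΦ.continuousOn
      (fun s _ y hy => by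
        show |deriv (fun v : ℝ => Real.smoothTransition (a + 1 - v)) (√(1 + ‖y‖ ^ 2) + 0 * s)| *
          (√(1 + ‖y‖ ^ 2) * ((3 / 2) * (u 0 s y ^ 2 + u 1 s y ^ 2) + (γhi / 2) * (w s y - wstar) ^ 2)) = 0
        rw [deriv_cutoff_eq_zero (hout s y hy), abs_zero, zero_mul])
    exact continuousOn_univ.1 h
  -- pointwise-in-height comparisons
  have hLS : ∀ s, L s ≤ S s := by
    intro s
    refine integral_mono (integrable_cutoff_mul a 0 s (continuous_const.mul ((contDiff_slice hd2 s).continuous)))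
      (integrable_cutoff_mul a 0 s (continuous_const.mul ((contDiff_slice hΘw s).continuous))) fun y => ?_
    have hχ0 : 0 ≤ Real.smoothTransition (a + 1 - (√(1 + ‖y‖ ^ 2) + 0 * s)) := Real.smoothTransition.nonneg _
    exact mul_le_mul_of_nonneg_left (bulk_bounds hΘ hΘ0 hGlo hGhi (w s y)).1 hχ0
  have hTR : ∀ s, |T s| ≤ R s := by
    intro s
    refine (abs_integral_le_integral_abs).trans (integral_mono ?_ ?_ fun y => ?_)
    · refine (Continuous.abs ?_).integrable_of_hasCompactSupport ?_
      · exact ((continuous_deriv_cutoff a 0 s).div (contDiff_bracket (k := 0)).continuous fun y => (bracket_pos y).ne').mul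
          (((continuous_const.mul (contDiff_bracket (k := 0)).continuous).mul (contDiff_slice he s).continuous).add
            (continuous_finsetSum _ fun i _ =>
              ((EuclideanSpace.proj (𝕜 := ℝ) i).continuous).mul (contDiff_slice (hf i) s).continuous))
      · exact ((hasCompactSupport_deriv_cutoff a 0 s).mul_right.mul_right).abs
    · refine (Continuous.mul ?_ ?_).integrable_of_hasCompactSupport ?_
      · exact (continuous_deriv_cutoff a 0 s).abs
      · exact (contDiff_bracket (k := 0)).continuous.mul
          ((continuous_const.mul (contDiff_slice hu2 s).continuous).add (continuous_const.mul (contDiff_slice hd2 s).continuous))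
      · exact (hasCompactSupport_deriv_cutoff a 0 s).abs.mul_right
    · exact abs_shell_integrand_le hΘ hΘ0 hG0 hGhi _ _ s y
  -- assemble over one period
  have h1 : ∫ s in (0 : ℝ)..P, L s ≤ ∫ s in (0 : ℝ)..P, S s :=
    intervalIntegral.integral_mono_on hP (hLc.intervalIntegrable _ _) (hSc.intervalIntegrable _ _) fun s _ => hLS s
  have h2 : -∫ s in (0 : ℝ)..P, T s ≤ ∫ s in (0 : ℝ)..P, R s := by
    have h3 : |∫ s in (0 : ℝ)..P, T s| ≤ ∫ s in (0 : ℝ)..P, |T s| :=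
      intervalIntegral.abs_integral_le_integral_abs hP
    have h4 : ∫ s in (0 : ℝ)..P, |T s| ≤ ∫ s in (0 : ℝ)..P, R s :=
      intervalIntegral.integral_mono_on hP (hTc.abs.intervalIntegrable _ _) (hRc.intervalIntegrable _ _) fun s _ => hTR s
    linarith [neg_abs_le (∫ s in (0 : ℝ)..P, T s)]
  calc ∫ s in (0 : ℝ)..P, L s ≤ ∫ s in (0 : ℝ)..P, S s := h1
    _ = -∫ s in (0 : ℝ)..P, T s := hid
    _ ≤ ∫ s in (0 : ℝ)..P, R s := h2

end Summit.NavierStokesRegularity.NavierStokesRegularity.Theorems.PoloidalWindowDoorPoloidalWindowRigidityZShockBreatherBound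

end
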